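import Summits.ResolutionOfSingularities.ResolutionOfSingularities.Theorems.PAlterationPialtFrobenius
import Summits.ResolutionOfSingularities.ResolutionOfSingularities.Theorems.PAlterationPialtRadicialCoverKit
import Summits.ResolutionOfSingularities.ResolutionOfSingularities.Theorems.PAlterationPicoverOfDegP
import Literature.AlgebraicGeometry.Resolution.NormalizationInNormal
import Literature.AlgebraicGeometry.Resolution.ResolutionGlue
import Mathlib.FieldTheory.PurelyInseparable.Exponent
import HarnessLib

/-!
# Crux `PalterationThesis` (stmt-ResolutionOfSingularities-0552), line `Sketch` rev. c2:
# the coindex induction for exponent-one radicial quotients of regular varieties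

Route `ResolutionOfSingularities/pAlteration`; helper file (`--supports stmt-0552`) proving the
registered stub `stub_quotientInduction` of the line's skeleton
(`Cruxes/PalterationThesis/Lines/Sketch.lean`, rev. c2). Over a perfect field `K` of
characteristic `p`, `ExpOneQuot_K m` says: every NORMAL integral separated `X` of finite type
over `K` which is the quotient of a REGULAR integral `W` by a finite, universally injective,
dominant `h : W → X` of EXPONENT ONE (`z^p ∈ K(X)` for all `z ∈ K(W)`) and degree
`[K(W) : K(X)] = p^m` has a resolution. Granted `R1_K` (= `ExpOneQuot_K 1` without the exponent
clause: the line's open residue `stub_r1Perfect`, quotients by ONE `p`-closed vector field) and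
`Core_K` in strong-induction form (stub `stub_core`), `stub_quotientInduction` proves
`ExpOneQuot_K m` for all `m` by strong induction:
* `m = 0` (`hasResolution_of_finrank_eq_one`): `h` is finite birational onto the normal `X`,
  hence an isomorphism (`isIso_morphismRestrict_of_isIntegralHom_of_normal`); `X` is regular.
* `m + 1` (`expOneQuot_succ`): pick `K(X) ⊆ L₁ ⊆ K(W)` with `[K(W) : L₁] = p` (`stub_pTower`);
  `X₁ := X^{L₁}` is normal and `W ≅ X^{K(W)} → X₁` (comparison `exists_isIso_comparison_of_normal`
  + domination `exists_hom_normalizationIn_of_algHom`) is finite radicial dominant of degree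
  `p`, so `R1_K` resolves `X₁` by some regular `X̃₁`, `K(X̃₁) ≅ L₁`. FROBENIUS TWIST: `𝕂 := K(X)`
  with the `K(X)`-algebra structure `x ↦ x^p` (`FunctionFieldOver F`, `F` the finite Frobenius
  power endomorphism of `X`) is a `K(X̃₁)`-algebra through `K(X̃₁) ≅ L₁ ⊆ K(W) → K(X)`,
  `z ↦ z^p` (exponent one), inside `K(X̃₁)^{1/p}` via `β : 𝕂 → K(X̃₁)`, the inclusion
  `K(X) ⊆ L₁ ≅ K(X̃₁)`, with `[K(X̃₁) : β 𝕂] = [L₁ : K(X)] = p^m`; so `Core_K m` (fed with the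
  induction hypothesis) resolves `X̃₁^𝕂`, `hasResolution_normalizationIn_of_isProper` transports
  this along the proper birational `X̃₁ → X₁ → X` to `X^𝕂 = X^{K(X), Frob}`, which is `≅ X` by
  the comparison for the finite Frobenius of the normal `X`.
-/

set_option linter.dupNamespace false
noncomputable section
open CategoryTheory AlgebraicGeometry TopologicalSpace
open Literature.AlgebraicGeometry.Resolution Literature.AlgebraicGeometry.Motives

namespace Summit.ResolutionOfSingularities.ResolutionOfSingularities.Theorems.PalterationThesis.PerfectQuotient

/-! ## Field-theoretic preliminaries -/

/-- A purely inseparable extension all of whose elements have their `p`-th power in the base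
has exponent `≤ 1`. [folklore] -/
theorem exponent_le_one_of_forall_pow_mem {F L : Type*} [Field F] [Field L] [Algebra F L]
    (p : ℕ) [ExpChar F p] [IsPurelyInseparable.HasExponent F L]
    (h : ∀ z : L, z ^ p ∈ (algebraMap F L).range) :
    IsPurelyInseparable.exponent F L ≤ 1 := by
  by_contra hlt
  obtain ⟨a, ha⟩ := IsPurelyInseparable.exponent_min' (K := F) (L := L) p (not_le.mp hlt)
  exact ha (by simpa using h a)

/-- A finite extension of degree one: the structure map is surjective. [folklore] -/
theorem algebraMap_surjective_of_finrank_eq_one {F L : Type*} [Field F] [Field L] [Algebra F L]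
    (h : Module.finrank F L = 1) : Function.Surjective (algebraMap F L) := by
  haveI : FiniteDimensional F L := Module.finite_of_finrank_eq_succ h
  intro x
  have hx : x ∈ (⊥ : Subalgebra F L) := by
    rw [Subalgebra.bot_eq_top_iff_finrank_eq_one.mpr h]
    exact Algebra.mem_top
  exact Algebra.mem_bot.mp hx

/-- The index of the range of a field homomorphism `j : F → L` in `L` is the degree of `L`
over `F` along `j`. [folklore] -/
theorem finrank_fieldRange_eq (F L : Type*) [Field F] [Field L] (j : F →+* L) :
    Module.finrank j.fieldRange L = @Module.finrank F L _ _ j.toAlgebra.toModule := by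
  letI : Algebra F L := j.toAlgebra
  symm
  refine Algebra.finrank_eq_of_equiv_equiv j.rangeRestrictFieldEquiv (RingEquiv.refl L) ?_
  ext x
  rfl

/-! ## The base case: degree one -/

/-- **Degree one.** A finite dominant morphism `h : W → X` of integral schemes with `X` normal
and `[K(W) : K(X)] = 1` is an isomorphism; in particular `X` is regular if `W` is, and then has
a resolution. [folklore] -/
theorem hasResolution_of_finrank_eq_one {X W : Scheme.{0}} [IsIntegral X] [IsIntegral W]
    (h : W ⟶ X) [IsDominant h] [IsFinite h]
    (hXn : ∀ x : X, IsIntegrallyClosed (X.presheaf.stalk x)) (hW : Scheme.IsRegular W)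
    (hdeg : Module.finrank X.functionField (FunctionFieldOver h) = 1) :
    Scheme.HasResolution X := by
  have hsurj : Function.Surjective (algebraMap X.functionField (FunctionFieldOver h)) :=
    algebraMap_surjective_of_finrank_eq_one hdeg
  have hbij : Function.Bijective (RatFn.functionFieldMap h) :=
    ⟨(RatFn.functionFieldMap h).injective, fun y => hsurj y⟩
  have hstalk : IsIso (h.stalkMap (genericPoint W)) :=
    Picover.OfNormalizationIn.isIso_stalkMap_genericPoint_of_bijective h hbij
  haveI : IsIso (h ∣_ (⊤ : X.Opens)) :=
    isIso_morphismRestrict_of_isIntegralHom_of_normal h hstalk ⊤ fun x _ => hXn x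
  haveI : IsIso h := isIso_of_isIso_morphismRestrict_top h
  exact (Scheme.IsRegular.of_iso h hW).hasResolution

/-! ## The induction step -/

/-- **The induction step** (see the module docstring): over a perfect field `K` of
characteristic `p`, granted `R1_K` and the conclusion of `Core_K` at `M`, every normal quotient
`X = W/h` of a regular `W` by a finite radicial dominant `h` of exponent one and degree `p^(M+1)`
has a resolution. [folklore] -/
theorem expOneQuot_succ (p : ℕ) (hp : p.Prime) (K : Type) [Field K] [CharP K p]
    [PerfectField K] (M : ℕ)
    (hR1 : ∀ (X W : Scheme.{0}) [IsIntegral X] [IsIntegral W] (f : X ⟶ Spec (.of K))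
      (h : W ⟶ X) [IsDominant h], IsSeparated f → LocallyOfFiniteType f → QuasiCompact f →
      (∀ x : X, IsIntegrallyClosed (X.presheaf.stalk x)) → Scheme.IsRegular W →
      IsFinite h → UniversallyInjective h →
      Module.finrank X.functionField (FunctionFieldOver h) = p →
      Scheme.HasResolution X)
    (hCoreM : ∀ (B : Scheme.{0}) [IsIntegral B] (f : B ⟶ Spec (.of K)),
        IsSeparated f → LocallyOfFiniteType f → QuasiCompact f → Scheme.IsRegular B →
        ∀ (E : Type) [Field E] [Algebra B.functionField E] [FiniteDimensional B.functionField E]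
          (β : E →+* B.functionField),
          (∀ b : B.functionField, β (algebraMap B.functionField E b) = b ^ p) →
          Module.finrank β.fieldRange B.functionField ≤ p ^ M →
          Scheme.HasResolution (normalizationIn B E))
    (X W : Scheme.{0}) [IsIntegral X] [IsIntegral W] (f : X ⟶ Spec (.of K)) (h : W ⟶ X)
    [IsDominant h] [IsSeparated f] [LocallyOfFiniteType f] [QuasiCompact f]
    (hXn : ∀ x : X, IsIntegrallyClosed (X.presheaf.stalk x)) (hWreg : Scheme.IsRegular W)
    [IsFinite h] [UniversallyInjective h]
    (hexp : ∀ z : FunctionFieldOver h,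
      z ^ p ∈ (algebraMap X.functionField (FunctionFieldOver h)).range)
    (hdeg : Module.finrank X.functionField (FunctionFieldOver h) = p ^ (M + 1)) :
    Scheme.HasResolution X := by
  haveI : Fact p.Prime := ⟨hp⟩
  haveI : CharP X.functionField p := Picover.TowerTransport.charP_functionField X f
  haveI : ExpChar X.functionField p := ExpChar.prime hp
  haveI : IsPurelyInseparable X.functionField (FunctionFieldOver h) :=
    Picover.FunctionFieldRadicial.stub_functionFieldRadicial W X h
  have hWn : ∀ w : W, IsIntegrallyClosed (W.presheaf.stalk w) := fun w => by
    haveI := hWreg w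
    exact isIntegrallyClosed_of_isRegularLocalRing _
  -- Step 1: an intermediate field `L₁` of index `p` below `K(W)`
  have hne : Module.finrank X.functionField (FunctionFieldOver h) ≠ 1 := by
    rw [hdeg]
    exact (Nat.one_lt_pow (Nat.succ_ne_zero M) hp.one_lt).ne'
  obtain ⟨L₁, hL₁⟩ := Picover.PTower.stub_pTower p X.functionField (FunctionFieldOver h) hne
  have hML₁ : Module.finrank X.functionField L₁ = p ^ M := by
    have htower := Module.finrank_mul_finrank X.functionField L₁ (FunctionFieldOver h)
    rw [hL₁, hdeg, pow_succ] at htower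
    exact Nat.eq_of_mul_eq_mul_right hp.pos htower
  haveI : IsPurelyInseparable X.functionField L₁ :=
    IsPurelyInseparable.tower_bot X.functionField L₁ (FunctionFieldOver h)
  -- Step 2: `X₁ := X^{L₁}`, normal, finite and radicial over `X`
  haveI : IsFinite (normalizationInι X L₁) := isFinite_normalizationInι X L₁ f
  haveI : UniversallyInjective (normalizationInι X L₁) :=
    universallyInjective_normalizationInι_of_isPurelyInseparable X L₁ p hXn
  have hX₁n : ∀ y : normalizationIn X L₁,
      IsIntegrallyClosed ((normalizationIn X L₁).presheaf.stalk y) :=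
    isIntegrallyClosed_stalk_normalizationIn X L₁
  obtain ⟨eX₁, heX₁⟩ :=
    Picover.FunctionFieldNormalizationIn.stub_functionField_normalizationIn X L₁
  -- Step 3: the lift `h₁ : W → X₁` of `h` (comparison `W ≅ X^{K(W)}` and domination)
  obtain ⟨φ, hφiso, hφh, -⟩ := exists_isIso_comparison_of_normal K X W f h hWn
  haveI := hφiso
  let e : FunctionFieldOver (normalizationInι X L₁) →ₐ[X.functionField] FunctionFieldOver h :=
    { toRingHom := (algebraMap L₁ (FunctionFieldOver h)).comp
        (eX₁.toRingHom : (normalizationIn X L₁).functionField →+* L₁)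
      commutes' := fun x => by
        change algebraMap L₁ (FunctionFieldOver h)
            (eX₁ (RatFn.functionFieldMap (normalizationInι X L₁) x)) = _
        have h1 := RingHom.congr_fun heX₁ x
        simp only [RingEquiv.toRingHom_eq_coe, RingHom.coe_comp, RingHom.coe_coe,
          Function.comp_apply] at h1
        rw [h1, ← IsScalarTower.algebraMap_apply] }
  obtain ⟨δ, hδι, hδint, hδdom⟩ :=
    Pialt.RadiciallyRegular.exists_hom_normalizationIn_of_algHom X (FunctionFieldOver h)
      (h := normalizationInι X L₁) e
  haveI := hδint
  haveI := hδdom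
  set h₁ : W ⟶ normalizationIn X L₁ := inv φ ≫ δ with hh₁def
  have hh₁ : h₁ ≫ normalizationInι X L₁ = h := by
    rw [hh₁def, Category.assoc, hδι, ← hφh, IsIso.inv_hom_id_assoc]
  haveI : IsFinite (normalizationInι X (FunctionFieldOver h)) :=
    isFinite_normalizationInι X (FunctionFieldOver h) f
  haveI : IsFinite δ := by
    have h1 : IsFinite (δ ≫ normalizationInι X L₁) := by rw [hδι]; infer_instance
    exact IsFinite.comp_iff.mp h1
  haveI : UniversallyInjective δ := by
    haveI : UniversallyInjective (δ ≫ normalizationInι X L₁) := by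
      rw [hδι, ← hφh]
      exact MorphismProperty.comp_mem _ φ h inferInstance inferInstance
    exact universallyInjective_of_comp δ (normalizationInι X L₁)
  haveI : IsFinite h₁ := by rw [hh₁def]; infer_instance
  haveI : UniversallyInjective h₁ := by
    rw [hh₁def]
    exact MorphismProperty.comp_mem _ (inv φ) δ inferInstance inferInstance
  haveI : IsDominant h₁ := by rw [hh₁def]; infer_instance
  -- Step 4: `h₁` has degree `p`
  have hdeg₁ : Module.finrank (normalizationIn X L₁).functionField (FunctionFieldOver h₁) = p := by
    have key : (RatFn.functionFieldMap h₁).comp (RatFn.functionFieldMap (normalizationInι X L₁)) =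
        RatFn.functionFieldMap h := by
      rw [← RatFn.functionFieldMap_comp]
      exact Picover.FunctionFieldNormalizationIn.functionFieldMap_congr hh₁
    letI algA : Algebra (FunctionFieldOver (normalizationInι X L₁)) (FunctionFieldOver h₁) :=
      (show FunctionFieldOver (normalizationInι X L₁) →+* FunctionFieldOver h₁ from
        RatFn.functionFieldMap h₁).toAlgebra
    letI algB : Algebra X.functionField (FunctionFieldOver h₁) :=
      (show X.functionField →+* FunctionFieldOver h₁ from RatFn.functionFieldMap h).toAlgebra
    haveI : IsScalarTower X.functionField (FunctionFieldOver (normalizationInι X L₁))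
        (FunctionFieldOver h₁) :=
      IsScalarTower.of_algebraMap_eq' key.symm
    have htower := Module.finrank_mul_finrank X.functionField
      (FunctionFieldOver (normalizationInι X L₁)) (FunctionFieldOver h₁)
    have h1 : Module.finrank X.functionField (FunctionFieldOver (normalizationInι X L₁)) =
        p ^ M := by
      rw [← hML₁]
      refine (AlgEquiv.ofRingEquiv (R := X.functionField)
        (A₁ := FunctionFieldOver (normalizationInι X L₁)) (A₂ := L₁)
        (f := show FunctionFieldOver (normalizationInι X L₁) ≃+* L₁ from eX₁) fun x => ?_)
          |>.toLinearEquiv.finrank_eq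
      have h1 := RingHom.congr_fun heX₁ x
      simp only [RingEquiv.toRingHom_eq_coe, RingHom.coe_comp, RingHom.coe_coe,
        Function.comp_apply] at h1
      exact h1
    have h2 : Module.finrank X.functionField (FunctionFieldOver h₁) = p ^ (M + 1) := hdeg
    rw [h1, h2, pow_succ] at htower
    exact Nat.eq_of_mul_eq_mul_left (pow_pos hp.pos M) htower
  -- Step 5: `R1` resolves `X₁`
  have hres₁ : Scheme.HasResolution (normalizationIn X L₁) :=
    hR1 (normalizationIn X L₁) W (normalizationInι X L₁ ≫ f) h₁ inferInstance inferInstance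
      inferInstance hX₁n hWreg inferInstance inferInstance hdeg₁
  obtain ⟨X₁', ρ, hρ⟩ := hres₁
  haveI : IsProper ρ := hρ.isProper
  haveI : IsReduced X₁' := hρ.isRegular.isReduced
  haveI : IsIntegral X₁' := hρ.isBirational.isIntegral
  haveI : IsDominant ρ := hρ.isBirational.isDominant
  have hbijρ : Function.Bijective (RatFn.functionFieldMap ρ) :=
    Picover.TowerTransport.bijective_functionFieldMap_of_isIso ρ
      hρ.isBirational.isIso_stalkMap_genericPoint
  let eρ : (normalizationIn X L₁).functionField ≃+* X₁'.functionField :=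
    RingEquiv.ofBijective _ hbijρ
  let θ : L₁ ≃+* X₁'.functionField := eX₁.symm.trans eρ
  -- Step 6: the finite Frobenius `F` of `X` and the twisted field `𝕂 = FunctionFieldOver F`
  have hpX : (p : Γ(X, ⊤)) = 0 := natCast_appTop_eq_zero p f
  have haddX := add_pow_sections p hpX 1
  set F := powEndo X (p ^ 1) (pow_ne_zero 1 hp.ne_zero) haddX with hFdef
  haveI : IsFinite F := isFinite_powEndo p f 1 haddX
  haveI : UniversallyInjective F := universallyInjective_powEndo X p 1 haddX hpX
  haveI : Surjective F := ⟨fun x => ⟨x, rfl⟩⟩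
  have hF : ∀ y : X.functionField, RatFn.functionFieldMap F y = y ^ p ^ 1 :=
    functionFieldMap_powEndo X (p ^ 1) _ haddX
  -- the `p`-th power map `K(W) → K(X)` (exponent one)
  have hexp1 : IsPurelyInseparable.exponent X.functionField (FunctionFieldOver h) ≤ 1 :=
    exponent_le_one_of_forall_pow_mem p hexp
  let lam : FunctionFieldOver h →+* X.functionField :=
    IsPurelyInseparable.iterateFrobenius X.functionField (FunctionFieldOver h) p hexp1
  have hlam : ∀ x : X.functionField,
      lam (algebraMap X.functionField (FunctionFieldOver h) x) = x ^ p := fun x => by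
    simp only [lam, IsPurelyInseparable.iterateFrobenius_algebraMap, pow_one]
  have hlam' : ∀ z : FunctionFieldOver h,
      algebraMap X.functionField (FunctionFieldOver h) (lam z) = z ^ p := fun z => by
    simp only [lam, IsPurelyInseparable.algebraMap_iterateFrobenius, pow_one]
  -- `𝕂` as a `K(X₁')`-algebra
  let μ : X₁'.functionField →+* FunctionFieldOver F :=
    (FunctionFieldOver.of F).toRingHom.comp
      (lam.comp ((algebraMap L₁ (FunctionFieldOver h)).comp θ.symm.toRingHom))
  letI algμ : Algebra X₁'.functionField (FunctionFieldOver F) := μ.toAlgebra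
  have hμ : ∀ y : X₁'.functionField, algebraMap X₁'.functionField (FunctionFieldOver F) y =
      FunctionFieldOver.of F (lam (algebraMap L₁ (FunctionFieldOver h) (θ.symm y))) :=
    fun _ => rfl
  have hcompat : (algebraMap X₁'.functionField (FunctionFieldOver F)).comp
      (RatFn.functionFieldMap (ρ ≫ normalizationInι X L₁)) =
        algebraMap X.functionField (FunctionFieldOver F) := by
    refine RingHom.ext fun x => ?_
    rw [RingHom.comp_apply, hμ, RatFn.functionFieldMap_comp, RingHom.comp_apply]
    have h1 : θ.symm (RatFn.functionFieldMap ρ (RatFn.functionFieldMap (normalizationInι X L₁) x)) =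
        eX₁ (RatFn.functionFieldMap (normalizationInι X L₁) x) := by
      change eX₁ (eρ.symm (eρ (RatFn.functionFieldMap (normalizationInι X L₁) x))) = _
      rw [RingEquiv.symm_apply_apply]
    have h2 : eX₁ (RatFn.functionFieldMap (normalizationInι X L₁) x) =
        algebraMap X.functionField L₁ x := by
      have h2 := RingHom.congr_fun heX₁ x
      simpa using h2
    rw [h1, h2, ← IsScalarTower.algebraMap_apply, hlam, FunctionFieldOver.algebraMap_apply, hF,
      pow_one]
  letI algXX₁' : Algebra X.functionField X₁'.functionField :=
    (RatFn.functionFieldMap (ρ ≫ normalizationInι X L₁)).toAlgebra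
  haveI : IsScalarTower X.functionField X₁'.functionField (FunctionFieldOver F) :=
    IsScalarTower.of_algebraMap_eq' hcompat.symm
  haveI : FiniteDimensional X₁'.functionField (FunctionFieldOver F) :=
    Module.Finite.of_restrictScalars_finite X.functionField X₁'.functionField (FunctionFieldOver F)
  -- `β : 𝕂 → K(X₁')`, the inclusion `K(X) ⊆ L₁ ≅ K(X₁')`
  let β : FunctionFieldOver F →+* X₁'.functionField :=
    θ.toRingHom.comp ((algebraMap X.functionField L₁).comp (FunctionFieldOver.of F).symm.toRingHom)
  have hβ : ∀ y : X₁'.functionField,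
      β (algebraMap X₁'.functionField (FunctionFieldOver F) y) = y ^ p := by
    intro y
    rw [hμ]
    change θ (algebraMap X.functionField L₁ ((FunctionFieldOver.of F).symm
      (FunctionFieldOver.of F (lam (algebraMap L₁ (FunctionFieldOver h) (θ.symm y)))))) = y ^ p
    rw [RingEquiv.symm_apply_apply]
    have h1 : algebraMap X.functionField (FunctionFieldOver h)
        (lam (algebraMap L₁ (FunctionFieldOver h) (θ.symm y))) =
          algebraMap L₁ (FunctionFieldOver h) ((θ.symm y) ^ p) := by
      rw [hlam', map_pow]
    have h2 : algebraMap X.functionField L₁ (lam (algebraMap L₁ (FunctionFieldOver h) (θ.symm y))) =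
        (θ.symm y) ^ p := by
      apply (algebraMap L₁ (FunctionFieldOver h)).injective
      rw [← IsScalarTower.algebraMap_apply, h1]
    rw [h2, map_pow, RingEquiv.apply_symm_apply]
  have hbound : Module.finrank β.fieldRange X₁'.functionField ≤ p ^ M := by
    rw [finrank_fieldRange_eq]
    letI algβ : Algebra (FunctionFieldOver F) X₁'.functionField := β.toAlgebra
    have h1 : Module.finrank (FunctionFieldOver F) X₁'.functionField =
        Module.finrank X.functionField L₁ := by
      symm
      refine Algebra.finrank_eq_of_equiv_equiv (FunctionFieldOver.of F) θ ?_
      refine RingHom.ext fun x => ?_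
      change β (FunctionFieldOver.of F x) = θ (algebraMap X.functionField L₁ x)
      change θ (algebraMap X.functionField L₁ ((FunctionFieldOver.of F).symm
        (FunctionFieldOver.of F x))) = _
      rw [RingEquiv.symm_apply_apply]
    exact (h1.trans hML₁).le
  -- Step 7: `Core` resolves `X₁'^𝕂`
  have hres' : Scheme.HasResolution (normalizationIn X₁' (FunctionFieldOver F)) :=
    hCoreM X₁' ((ρ ≫ normalizationInι X L₁) ≫ f) inferInstance inferInstance inferInstance
      hρ.isRegular (FunctionFieldOver F) β hβ hbound
  -- Step 8: transport to `X^𝕂` along the proper birational `X₁' → X₁ → X`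
  have hfib : ∀ w' : X₁', (ρ ≫ normalizationInι X L₁) w' = genericPoint X →
      w' = genericPoint X₁' := by
    intro w' hw'
    rw [Scheme.Hom.comp_apply] at hw'
    have h1 : ρ w' = genericPoint (normalizationIn X L₁) :=
      Picover.TowerTransport.eq_genericPoint_of_isIntegralHom (normalizationInι X L₁) hw'
    obtain ⟨U, hU, -, hUiso⟩ := hρ.isBirational
    haveI := hUiso
    have hηU : genericPoint (normalizationIn X L₁) ∈ U :=
      ((genericPoint_spec (normalizationIn X L₁)).mem_open_set_iff U.isOpen).mpr
        (by simpa using hU.nonempty)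
    exact Picover.TowerTransport.subsingleton_preimage_of_isIso_morphismRestrict ρ U hηU h1
      (RatFn.genericPoint_eq_of_isDominant ρ)
  have hresX : Scheme.HasResolution (normalizationIn X (FunctionFieldOver F)) :=
    Picover.TowerTransport.hasResolution_normalizationIn_of_isProper
      Picover.FunctionFieldNormalizationIn.stub_functionField_normalizationIn X f
      (FunctionFieldOver F) X₁' (ρ ≫ normalizationInι X L₁) hcompat hfib hres'
  -- Step 9: `X^𝕂 = X^{K(X), Frob} ≅ X`
  obtain ⟨φX, hφX, -, -⟩ := exists_isIso_comparison_of_normal K X X f F hXn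
  haveI := hφX
  exact Scheme.HasResolution.of_iso φX hresX

/-! ## The stub -/

/-- **The coindex induction** (registered stub `stub_quotientInduction` of line `Sketch`,
statement verbatim). Over a perfect field `K` of characteristic `p`, granted `R1_K` (degree-`p`
radicial quotients of regular varieties are resolvable) and `Core_K` in strong-induction form,
every normal quotient of a regular variety by a finite radicial dominant morphism of exponent
one has a resolution, whatever its degree `p^m`: strong induction on `m`, the case `m = 0` by
`hasResolution_of_finrank_eq_one` and the step by `expOneQuot_succ`. [folklore] -/
theorem stub_quotientInduction (p : ℕ) (hp : p.Prime) (K : Type) [Field K] [CharP K p]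
    [PerfectField K]
    (hR1 : ∀ (X W : Scheme.{0}) [IsIntegral X] [IsIntegral W] (f : X ⟶ Spec (.of K))
      (h : W ⟶ X) [IsDominant h], IsSeparated f → LocallyOfFiniteType f → QuasiCompact f →
      (∀ x : X, IsIntegrallyClosed (X.presheaf.stalk x)) → Scheme.IsRegular W →
      IsFinite h → UniversallyInjective h →
      Module.finrank X.functionField (FunctionFieldOver h) = p →
      Scheme.HasResolution X)
    (hCore : ∀ M : ℕ,
      (∀ m : ℕ, m ≤ M → ∀ (X W : Scheme.{0}) [IsIntegral X] [IsIntegral W]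
        (f : X ⟶ Spec (.of K)) (h : W ⟶ X) [IsDominant h],
        IsSeparated f → LocallyOfFiniteType f → QuasiCompact f →
        (∀ x : X, IsIntegrallyClosed (X.presheaf.stalk x)) → Scheme.IsRegular W →
        IsFinite h → UniversallyInjective h →
        (∀ z : FunctionFieldOver h,
          z ^ p ∈ (algebraMap X.functionField (FunctionFieldOver h)).range) →
        Module.finrank X.functionField (FunctionFieldOver h) = p ^ m →
        Scheme.HasResolution X) →
      ∀ (B : Scheme.{0}) [IsIntegral B] (f : B ⟶ Spec (.of K)),
        IsSeparated f → LocallyOfFiniteType f → QuasiCompact f → Scheme.IsRegular B →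
        ∀ (E : Type) [Field E] [Algebra B.functionField E] [FiniteDimensional B.functionField E]
          (β : E →+* B.functionField),
          (∀ b : B.functionField, β (algebraMap B.functionField E b) = b ^ p) →
          Module.finrank β.fieldRange B.functionField ≤ p ^ M →
          Scheme.HasResolution (normalizationIn B E)) :
    ∀ (m : ℕ) (X W : Scheme.{0}) [IsIntegral X] [IsIntegral W] (f : X ⟶ Spec (.of K))
      (h : W ⟶ X) [IsDominant h], IsSeparated f → LocallyOfFiniteType f → QuasiCompact f →
      (∀ x : X, IsIntegrallyClosed (X.presheaf.stalk x)) → Scheme.IsRegular W →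
      IsFinite h → UniversallyInjective h →
      (∀ z : FunctionFieldOver h,
        z ^ p ∈ (algebraMap X.functionField (FunctionFieldOver h)).range) →
      Module.finrank X.functionField (FunctionFieldOver h) = p ^ m →
      Scheme.HasResolution X := by
  intro m
  induction m using Nat.strong_induction_on with
  | _ m IH =>
    intro X W _ _ f h _ hsep hlft hqc hXn hWreg hfin hui hexp hdeg
    cases m with
    | zero =>
      rw [pow_zero] at hdeg
      exact hasResolution_of_finrank_eq_one h hXn hWreg hdeg
    | succ M =>
      exact expOneQuot_succ p hp K M hR1
        (hCore M fun m hm => IH m (Nat.lt_succ_of_le hm)) X W f h hXn hWreg hexp hdeg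

end Summit.ResolutionOfSingularities.ResolutionOfSingularities.Theorems.PalterationThesis.PerfectQuotient

end
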